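import Summits.QuantumFields.YangMills.Theorems.FluctuationComparisonRegPrIntLS2BetaChartContWindowChart
import Summits.QuantumFields.YangMills.Theorems.FluctuationComparisonRegPrIntLS2BetaResidualSubgroup
import Summits.QuantumFields.YangMills.Theorems.FluctuationComparisonRegPrIntLS2BetaResidualGaugeCentral
import HarnessLib

/-!
# CHART∞ · V-c3 (LINE g18-1 `semiclassical_s2beta`, organ S2β, LAPLACE row): THE NINE CHART∞ ROWS OF LIMIT-INST for `pivotAct`, from the carrier rows

Cell `ym3-torus` (rung R3: continuum `SU(2)` Yang–Mills on `T³` — NOT `d = 4`, NOT infinite volume, NOT a mass gap, NOT Clay); width seat `ym-ust-20520-w3` g14;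
helper of the crux `stmt-QuantumFields-20520` (`--supports`, NOT a proof of it).  THEOREMS ONLY (0 `def`, default heartbeats).

WHAT.  ✓LIMIT-INST `…S2BetaLaplaceInst.laplaceLimit_of_charts(_tendsto)` asks, at a corner `V` of a window chart `c` on `Sf = histGood`, for a set `Xc` with
`hXc` (compact) · `hXinv` (invariant under the (β″) action `act`) · `hvan` (`c.jac (V,·) = 0` off `Xc`) · `hA`, `ha` (`wilsonAction4 ∘ c.Φ (V,·)` and `c.jac (V,·)`
continuous on `Xc`) · `hAinv`, `hainv` (invariant on `Xc`) · `hOrel` (`{c.Φ (V,·) ∈ Sf}` relatively open in `Xc`) · `hOinv`.  THIS FILE derives all nine, for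
px11's `act := pivotAct F hJK (iterCentralBond (K − J))` (✓`…S2BetaResidualSubgroup.pivotAct`: residual gauge factor, then LEFT pivot translations) and
**`Xc := {z | c.jac (V, z) ≠ 0}`**, from the CARRIER ROWS of ✓V-c2 `exists_windowChart_cont` (compactness, `ContinuousOn`, pivot blindness — hypothesis-free in the
tree) and TWO displayed RESIDUAL-GAUGE COVARIANCE rows of the chart (`hjcov : c.jac (V, w•z) = c.jac (V, z)`, `hΦcov : c.jac (V,z) ≠ 0 → c.Φ (V, w•z) = w • c.Φ (V, z)`
for `w ∈ residualSubgroup F hJK` — CHART∞ V-b's deliverable), with ✓`wilsonAction4_gaugeAct`, ✓`gaugeAct_mem_histGood_iff_residual`, ✓`isOpen_histGood`, lit ✓`B16Thm1BaseAtRecord11.continuous_wilsonAction4_SU`: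
★★★ `laplaceRows_of_carrier`; and then HYPOTHESIS-FREE (§2): every residual transformation acts trivially on the coarse lattice
(`gaugeAct_transfUp_eq_self_of_residual`, from ✓`exists_descTransf_eq_const_of_residual`), so ✓V-c2's covariance conjunct delivers the two rows and ★★★
`exists_laplaceRows` states the nine rows at every corner of the window chart of record.  `hvan` is DEFINITIONAL for this `Xc` — the seam of w3-20520 g13's ‼ 18:02Z is closed by the choice of the chart of record
(closed-profile Jacobian, V-c1), not by a row change.
HONEST SCOPE.  Bookkeeping∕assembly; LAPLACE ∕ S2β ∕ crux 20520 NOT proved; `YM3TorusSU2` NOT proved; the Yang–Mills mass gap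
(Clay) NOT proved.  [cite: Balaban1987RG1, (2.10) p.267] [cite: Balaban1985Averaging, (8) p.19] [cite: Balaban1985UV3, (7) p.257]
-/

noncomputable section

open MeasureTheory Filter Topology Set
open scoped ENNReal NNReal
open Literature.MathematicalPhysics.QuantumFieldTheory.Balaban1983to89
open Literature.MathematicalPhysics.QuantumFieldTheory.Balaban1983to89.T3ContinuumYM3Torus
open Literature.MathematicalPhysics.QuantumFieldTheory.Balaban1983to89.T3UnitLawDensityEML
open Literature.MathematicalPhysics.QuantumFieldTheory.Balaban1983to89.T3UnitScaleTilt
open Literature.MathematicalPhysics.QuantumFieldTheory.Balaban1983to89.T3TiltDescent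
open Literature.MathematicalPhysics.QuantumFieldTheory.Balaban1983to89.T3PrintedRegularOrbits
open Literature.MathematicalPhysics.QuantumFieldTheory.Balaban1983to89.T3LevelShift
open Literature.MathematicalPhysics.QuantumFieldTheory.Balaban1983to89.T3Thresholds
open Literature.MathematicalPhysics.QuantumFieldTheory.Balaban1983to89.T4Continuum
open scoped Literature.MathematicalPhysics.QuantumFieldTheory.Balaban1983to89.T3OrbitAverage

namespace Summit.QuantumFields.YangMills.Theorems.FluctuationComparisonRegPrIntLS2BetaChartContLaplaceRows

open Summit.QuantumFields.YangMills.Theorems.FluctuationComparisonRegPrIntLWregChain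
open Summit.QuantumFields.YangMills.Theorems.FluctuationComparisonRegPrIntLWregGlue
open Summit.QuantumFields.YangMills.Theorems.FluctuationComparisonRegPrIntLWregInterior
open Summit.QuantumFields.YangMills.Theorems.FluctuationComparisonRegPrIntLS2BetaChartContCarrier (isOpen_coe_preimage_of_continuousOn)
open Summit.QuantumFields.YangMills.Theorems.FluctuationComparisonRegPrIntLS2BetaResidualGauge (wilsonAction4_gaugeAct gaugeAct_const_of_comm)
open Summit.QuantumFields.YangMills.Theorems.FluctuationComparisonRegPrIntLS2BetaResidualSubgroup
open Function

/-- ★★★ **THE NINE CHART∞ ROWS OF LIMIT-INST AT A CORNER, FOR `pivotAct` AND `Xc := {c.jac (V,·) ≠ 0}`**, from the carrier rows of the window chart of record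
(✓V-c2) and two displayed residual-gauge covariance rows (CHART∞ V-b): compactness, `pivotAct`-invariance, vanishing off `Xc` (definitional), continuity of
`wilsonAction4 ∘ c.Φ (V,·)` and of `c.jac (V,·)` on `Xc`, their invariance, relative openness and invariance of the event `{c.Φ (V,·) ∈ histGood}`.
[cite: Balaban1987RG1, (2.10) p.267] [cite: Balaban1985Averaging, (8) p.19] [cite: Balaban1985UV3, (7) p.257] -/
theorem laplaceRows_of_carrier (F : T3Family) {J K : ℕ} (hJK : J ≤ K) {θ : ℕ → ℝ} {δ₁ : ℝ} (hδ₁ : 0 ≤ δ₁) (hθ : ∀ i, θ i ≤ δ₁)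
    (hsmall : (((((F.P K).d + 2) * (F.P K).L : ℕ) : ℝ) ^ 2 / 4) * δ₁ ≤ ExpMeanLog.deltaSU (Fin 2) / 2)
    {O : Set (GaugeField (F.P J) 0 (Matrix.specialUnitaryGroup (Fin 2) ℂ))} (c : WindowChart F hJK (histGood F ℰp θ K J) O)
    -- carrier rows (✓V-c2 `exists_windowChart_cont`)
    (hcompact : ∀ V, IsCompact {z | c.jac (V, z) ≠ 0})
    (hcontOn : ∀ V, ContinuousOn (fun z => c.Φ (V, z)) {z | c.jac (V, z) ≠ 0} ∧ ContinuousOn (fun z => c.jac (V, z)) {z | c.jac (V, z) ≠ 0})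
    (hjbl : ∀ V z (g : PBond (F.P K) (K - J) → Matrix.specialUnitaryGroup (Fin 2) ℂ), c.jac (V, Function.extend (iterCentralBond (K - J)) g z) = c.jac (V, z))
    (hΦbl : ∀ V z (g : PBond (F.P K) (K - J) → Matrix.specialUnitaryGroup (Fin 2) ℂ), c.jac (V, z) ≠ 0 →
      c.Φ (V, Function.extend (iterCentralBond (K - J)) g z) = c.Φ (V, z))
    -- residual-gauge covariance rows (CHART∞ V-b)
    (hjcov : ∀ (k : residualSubgroup F hJK) V z,
      c.jac (V, GaugeField.gaugeAct (k : Site (F.P K) 0 → Matrix.specialUnitaryGroup (Fin 2) ℂ) z) = c.jac (V, z))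
    (hΦcov : ∀ (k : residualSubgroup F hJK) V z, c.jac (V, z) ≠ 0 →
      c.Φ (V, GaugeField.gaugeAct (k : Site (F.P K) 0 → Matrix.specialUnitaryGroup (Fin 2) ℂ) z) =
        GaugeField.gaugeAct (k : Site (F.P K) 0 → Matrix.specialUnitaryGroup (Fin 2) ℂ) (c.Φ (V, z)))
    (V : GaugeField (F.P J) 0 (Matrix.specialUnitaryGroup (Fin 2) ℂ)) :
    IsCompact {z | c.jac (V, z) ≠ 0} ∧
    (∀ k z, z ∈ {z | c.jac (V, z) ≠ 0} → pivotAct F hJK (iterCentralBond (K - J)) k z ∈ {z | c.jac (V, z) ≠ 0}) ∧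
    (∀ z, z ∉ {z | c.jac (V, z) ≠ 0} → (c.jac (V, z) : ℝ) = 0) ∧
    ContinuousOn (fun z => wilsonAction4 (c.Φ (V, z))) {z | c.jac (V, z) ≠ 0} ∧
    ContinuousOn (fun z => (c.jac (V, z) : ℝ)) {z | c.jac (V, z) ≠ 0} ∧
    (∀ k, ∀ z ∈ {z | c.jac (V, z) ≠ 0}, wilsonAction4 (c.Φ (V, pivotAct F hJK (iterCentralBond (K - J)) k z)) = wilsonAction4 (c.Φ (V, z))) ∧
    (∀ k, ∀ z ∈ {z | c.jac (V, z) ≠ 0}, (c.jac (V, pivotAct F hJK (iterCentralBond (K - J)) k z) : ℝ) = c.jac (V, z)) ∧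
    IsOpen ((Subtype.val : {z | c.jac (V, z) ≠ 0} → GaugeField (F.P K) 0 (Matrix.specialUnitaryGroup (Fin 2) ℂ)) ⁻¹'
      {z | c.Φ (V, z) ∈ histGood F ℰp θ K J}) ∧
    (∀ k, ∀ z ∈ {z | c.jac (V, z) ≠ 0}, c.Φ (V, z) ∈ histGood F ℰp θ K J →
      c.Φ (V, pivotAct F hJK (iterCentralBond (K - J)) k z) ∈ histGood F ℰp θ K J) := by
  -- `pivotAct k z = (k.1 • z)[βₙ ↦ …]`: the chart and its Jacobian read only the gauge factor (pivot blindness), then covariance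
  have hjac_act : ∀ (k : residualSubgroup F hJK × (PBond (F.P K) (K - J) → Matrix.specialUnitaryGroup (Fin 2) ℂ)) z,
      c.jac (V, pivotAct F hJK (iterCentralBond (K - J)) k z) = c.jac (V, z) := fun k z => by
    rw [pivotAct, hjbl, hjcov]
  have hΦ_act : ∀ (k : residualSubgroup F hJK × (PBond (F.P K) (K - J) → Matrix.specialUnitaryGroup (Fin 2) ℂ)) z, c.jac (V, z) ≠ 0 →
      c.Φ (V, pivotAct F hJK (iterCentralBond (K - J)) k z) =
        GaugeField.gaugeAct (k.1 : Site (F.P K) 0 → Matrix.specialUnitaryGroup (Fin 2) ℂ) (c.Φ (V, z)) := fun k z hz => by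
    have hz' : c.jac (V, GaugeField.gaugeAct (k.1 : Site (F.P K) 0 → Matrix.specialUnitaryGroup (Fin 2) ℂ) z) ≠ 0 := by rwa [hjcov]
    rw [pivotAct, hΦbl _ _ _ hz', hΦcov _ _ _ hz]
  obtain ⟨hΦc, hjc⟩ := hcontOn V
  refine ⟨hcompact V, fun k z hz => ?_, fun z hz => ?_, ?_, ?_, fun k z hz => ?_, fun k z _ => ?_, ?_, fun k z hz hgood => ?_⟩
  · show c.jac (V, pivotAct F hJK (iterCentralBond (K - J)) k z) ≠ 0
    rw [hjac_act]
    exact hz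
  · simpa only [mem_setOf_eq, not_not, NNReal.coe_eq_zero] using hz
  · exact (B16Thm1BaseAtRecord11.continuous_wilsonAction4_SU (N := 2) (F.P K) 0).comp_continuousOn hΦc
  · exact NNReal.continuous_coe.comp_continuousOn hjc
  · rw [hΦ_act k z hz, wilsonAction4_gaugeAct]
  · rw [hjac_act]
  · exact isOpen_coe_preimage_of_continuousOn hΦc (isOpen_histGood F hδ₁ hθ hsmall hJK)
  · rw [hΦ_act k z hz]
    exact (gaugeAct_mem_histGood_iff_residual F hJK k.1 θ J (c.Φ (V, z))).2 hgood

/-! ## §2 Residual transformations act trivially on the coarse lattice; the rows, hypothesis-free -/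

/-- ★ A residual gauge transformation acts trivially on EVERY coarse field: `(transfUp w (K−J)) • V' = V'` (its restriction is a central constant,
✓`exists_descTransf_eq_const_of_residual`). [cite: Balaban1985Variational, (4) p.278; Balaban1985Averaging, (11) p.19] -/
theorem gaugeAct_transfUp_eq_self_of_residual (F : T3Family) {J K : ℕ} (hJK : J ≤ K) (k : residualSubgroup F hJK)
    (V' : GaugeField (F.P K) (K - J) (Matrix.specialUnitaryGroup (Fin 2) ℂ)) :
    GaugeField.gaugeAct (transfUp (k : Site (F.P K) 0 → Matrix.specialUnitaryGroup (Fin 2) ℂ) (K - J)) V' = V' := by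
  obtain ⟨c, hc, hdesc⟩ :=
    Summit.QuantumFields.YangMills.Theorems.FluctuationComparisonRegPrIntLS2BetaResidualGaugeCentral.exists_descTransf_eq_const_of_residual F hJK k.2
  have hconst : ∀ y, transfUp (k : Site (F.P K) 0 → Matrix.specialUnitaryGroup (Fin 2) ℂ) (K - J) y = c := fun y => by
    have h := congrFun hdesc ((siteShift (T3PrintedRegularOrbits.sites_eq F J K hJK)).symm y)
    simpa only [descTransf, Equiv.apply_symm_apply] using h
  have hfun : (transfUp (k : Site (F.P K) 0 → Matrix.specialUnitaryGroup (Fin 2) ℂ) (K - J) :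
      GaugeTransf (F.P K) (K - J) (Matrix.specialUnitaryGroup (Fin 2) ℂ)) = fun _ => c := funext hconst
  rw [hfun]
  exact gaugeAct_const_of_comm hc V'

/-- ★★★ **THE NINE CHART∞ ROWS OF LIMIT-INST AT EVERY CORNER, HYPOTHESIS-FREE** — ✓V-c2 `exists_windowChart_cont` (the window chart of record with its carrier and
covariance rows) + `gaugeAct_transfUp_eq_self_of_residual` + ★★★`laplaceRows_of_carrier`: for every `L, b₀, p₀ > 0` a `γ₁ > 0` such that for every family with
`F.L = L`, `0 < γ ≤ γ₁`, `J ≤ K`, the window `O = {PlaqSmall (θBal J)}` carries a `WindowChart c` on `histGood` (with the exported clauses: live ⇒ descends, live-point characterisation,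
`ContinuousOn` of `c.Φ (V,·)` ∕ `c.jac (V,·)` on the carrier, pivot blindness of `T` ∕ `c.jac` ∕ `c.Φ`, self-charting of fibre points, `charted`, covariance under
coarse-trivial gauge transformations, «residual ⇒ coarse-trivial», «the carrier is a NEIGHBOURHOOD of every `U ∈ fibre V ∩ histGood`», and the α-free RECOGNITION
clause «a closed-profile fibre field over `V` with `z`'s off-pivot coordinates IS `c.Φ (V,z)`, `z` live») AND, at every `V`, the rows `hXc ∕ hXinv ∕ hvan ∕ hA ∕ ha ∕ hAinv ∕ hainv ∕ hOrel ∕ hOinv` of ✓`laplaceLimit_of_charts(_tendsto)` for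
`act := pivotAct F hJK (iterCentralBond (K − J))` and `Xc := {z | c.jac (V, z) ≠ 0}`.
[cite: Balaban1987RG1, (0.4) p.253, (2.4) p.266 and (2.10) p.267] [cite: Balaban1985Averaging, (8) p.19 and (11) p.19] [cite: Balaban1985UV3, (7) p.257] -/
theorem exists_laplaceRows :
    ∀ (L : ℕ) (b₀ p₀ : ℝ), 0 < b₀ → 0 < p₀ → ∃ γ₁ : ℝ, 0 < γ₁ ∧ ∀ (F : T3Family) (γ : ℝ), F.L = L → 0 < γ → γ ≤ γ₁ →
      ∀ (J K : ℕ) (hJK : J ≤ K),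
        ∃ (c : WindowChart F hJK (histGood F ℰp (θBal F.L γ b₀ p₀) K J) {V | PlaqSmall (θBal F.L γ b₀ p₀ J) V})
          (T : PBond (F.P K) (K - J) → GaugeField (F.P K) 0 (Matrix.specialUnitaryGroup (Fin 2) ℂ) → Set (Matrix.specialUnitaryGroup (Fin 2) ℂ))
          (w : PBond (F.P K) (K - J) → PBond (F.P J) 0),
          (∀ V z, c.jac (V, z) ≠ 0 → descendTo F ℰp J K hJK (c.Φ (V, z)) = V) ∧
          (∀ V z, c.jac (V, z) ≠ 0 ↔ (∀ c', V (w c') ∈ T c' z) ∧ c.Φ (V, z) ∈ closure (histGood F ℰp (θBal F.L γ b₀ p₀) K J)) ∧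
          (∀ V, ContinuousOn (fun z => c.Φ (V, z)) {z | c.jac (V, z) ≠ 0} ∧ ContinuousOn (fun z => c.jac (V, z)) {z | c.jac (V, z) ≠ 0}) ∧
          (∀ c' z (g : PBond (F.P K) (K - J) → Matrix.specialUnitaryGroup (Fin 2) ℂ), T c' (Function.extend (iterCentralBond (K - J)) g z) = T c' z) ∧
          (∀ V z (g : PBond (F.P K) (K - J) → Matrix.specialUnitaryGroup (Fin 2) ℂ), c.jac (V, Function.extend (iterCentralBond (K - J)) g z) = c.jac (V, z)) ∧
          (∀ V z (g : PBond (F.P K) (K - J) → Matrix.specialUnitaryGroup (Fin 2) ℂ), c.jac (V, z) ≠ 0 →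
            c.Φ (V, Function.extend (iterCentralBond (K - J)) g z) = c.Φ (V, z)) ∧
          (∀ V U, descendTo F ℰp J K hJK U = V → U ∈ closure (histGood F ℰp (θBal F.L γ b₀ p₀) K J) → c.jac (V, U) ≠ 0 ∧ c.Φ (V, U) = U) ∧
          (∀ V z, (∀ c', V (w c') ∈ T c' z) → (∀ b, (∀ c', iterCentralBond (K - J) c' ≠ b) → c.Φ (V, z) b = z b) ∧
            descendTo F ℰp J K hJK (c.Φ (V, z)) = V) ∧
          (∀ (u : GaugeTransf (F.P K) 0 (Matrix.specialUnitaryGroup (Fin 2) ℂ)),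
            (∀ V' : GaugeField (F.P K) (K - J) (Matrix.specialUnitaryGroup (Fin 2) ℂ), GaugeField.gaugeAct (transfUp u (K - J)) V' = V') →
            ∀ V z, c.jac (V, GaugeField.gaugeAct u z) = c.jac (V, z) ∧
              (c.jac (V, z) ≠ 0 → c.Φ (V, GaugeField.gaugeAct u z) = GaugeField.gaugeAct u (c.Φ (V, z)))) ∧
          (∀ (k : residualSubgroup F hJK) (V' : GaugeField (F.P K) (K - J) (Matrix.specialUnitaryGroup (Fin 2) ℂ)),
            GaugeField.gaugeAct (transfUp (k : Site (F.P K) 0 → Matrix.specialUnitaryGroup (Fin 2) ℂ) (K - J)) V' = V') ∧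
          (∀ V U, descendTo F ℰp J K hJK U = V → U ∈ histGood F ℰp (θBal F.L γ b₀ p₀) K J → {z | c.jac (V, z) ≠ 0} ∈ 𝓝 U) ∧
          (∀ V z U', U' ∈ closure (histGood F ℰp (θBal F.L γ b₀ p₀) K J) → descendTo F ℰp J K hJK U' = V →
            (∀ b, (∀ c', iterCentralBond (K - J) c' ≠ b) → U' b = z b) → c.jac (V, z) ≠ 0 ∧ c.Φ (V, z) = U') ∧
          ∀ V : GaugeField (F.P J) 0 (Matrix.specialUnitaryGroup (Fin 2) ℂ),
            IsCompact {z | c.jac (V, z) ≠ 0} ∧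
            (∀ k z, z ∈ {z | c.jac (V, z) ≠ 0} → pivotAct F hJK (iterCentralBond (K - J)) k z ∈ {z | c.jac (V, z) ≠ 0}) ∧
            (∀ z, z ∉ {z | c.jac (V, z) ≠ 0} → (c.jac (V, z) : ℝ) = 0) ∧
            ContinuousOn (fun z => wilsonAction4 (c.Φ (V, z))) {z | c.jac (V, z) ≠ 0} ∧
            ContinuousOn (fun z => (c.jac (V, z) : ℝ)) {z | c.jac (V, z) ≠ 0} ∧
            (∀ k, ∀ z ∈ {z | c.jac (V, z) ≠ 0},
              wilsonAction4 (c.Φ (V, pivotAct F hJK (iterCentralBond (K - J)) k z)) = wilsonAction4 (c.Φ (V, z))) ∧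
            (∀ k, ∀ z ∈ {z | c.jac (V, z) ≠ 0}, (c.jac (V, pivotAct F hJK (iterCentralBond (K - J)) k z) : ℝ) = c.jac (V, z)) ∧
            IsOpen ((Subtype.val : {z | c.jac (V, z) ≠ 0} → GaugeField (F.P K) 0 (Matrix.specialUnitaryGroup (Fin 2) ℂ)) ⁻¹'
              {z | c.Φ (V, z) ∈ histGood F ℰp (θBal F.L γ b₀ p₀) K J}) ∧
            (∀ k, ∀ z ∈ {z | c.jac (V, z) ≠ 0}, c.Φ (V, z) ∈ histGood F ℰp (θBal F.L γ b₀ p₀) K J →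
              c.Φ (V, pivotAct F hJK (iterCentralBond (K - J)) k z) ∈ histGood F ℰp (θBal F.L γ b₀ p₀) K J) := by
  intro L b₀ p₀ hb hp
  obtain ⟨γ₁, hγ₁, hmain⟩ := Summit.QuantumFields.YangMills.Theorems.FluctuationComparisonRegPrIntLS2BetaChartContWindowChart.exists_windowChart_cont L b₀ p₀ hb hp
  obtain ⟨δ', γ₂, hδ', hγ₂, hreg⟩ := Summit.QuantumFields.YangMills.Theorems.FluctuationComparisonRegPrIntLWregAssembly.exists_gamma_levelRegime L b₀ p₀ hb hp
  refine ⟨min γ₁ γ₂, lt_min hγ₁ hγ₂, fun F γ hFL hγ hγle J K hJK => ?_⟩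
  obtain ⟨c, T, w, hfib, hne, hcompact, hcontOn, hTbl, hjbl, hΦbl, hself, hcharted, hcov, hnhds, hrecog⟩ :=
    hmain F γ hFL hγ (hγle.trans (min_le_left _ _)) J K hJK
  obtain ⟨hsmall, hθlt⟩ := hreg F γ hFL hγ (hγle.trans (min_le_right _ _)) K
  refine ⟨c, T, w, hfib, hne, hcontOn, hTbl, hjbl, hΦbl, hself, hcharted, hcov, gaugeAct_transfUp_eq_self_of_residual F hJK, hnhds, hrecog,
    fun V => ?_⟩
  exact laplaceRows_of_carrier F hJK hδ'.le (fun i => (hθlt i).le) hsmall c hcompact hcontOn hjbl hΦbl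
    (fun k V z => (hcov (k : Site (F.P K) 0 → Matrix.specialUnitaryGroup (Fin 2) ℂ) (gaugeAct_transfUp_eq_self_of_residual F hJK k) V z).1)
    (fun k V z hj => (hcov (k : Site (F.P K) 0 → Matrix.specialUnitaryGroup (Fin 2) ℂ) (gaugeAct_transfUp_eq_self_of_residual F hJK k) V z).2 hj) V

end Summit.QuantumFields.YangMills.Theorems.FluctuationComparisonRegPrIntLS2BetaChartContLaplaceRows

end
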